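import Literature.Analysis.FluidPDE.GaussianVortexBiotSavartBound
import Literature.Analysis.FluidPDE.GaussianVortexFormDomainTrunc
import Literature.Analysis.FunctionSpaces.SobolevDomainProofs
import Literature.Analysis.OperatorTheory.AbstractHodgeDecomposition
import Literature.Analysis.OperatorTheory.PeetreLemma
import HarnessLib

/-!
# Compactness of the embedding `H¹(μ_λ) ↪ L²(μ_λ)` (Gaussian-weighted Rellich theorem)

Analysis/FluidPDE file (all results proved, no definitions, no named facts), part of the
existence theory behind the named fact `GallayMaekawa2016_thm41` (Gallay–Maekawa 2016, Thm. 4.1,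
Leray–Schauder part: compactness of the fixed-point map). For `λ ∈ [0,1)` the first components
of a bounded subset of the form domain `H = H¹(μ_λ)` (`GaussianVortexFormDomain`) form a totally
bounded subset of `L²(μ_λ)` (`totallyBounded_fst_of_norm_le`), hence have compact closure: the
Ornstein–Uhlenbeck-type operator `L_λ` has compact resolvent (Gallay–Maekawa 2016, §4.1).

Proof: it suffices that every sequence `uₙ = π₁Uₙ`, `‖Uₙ‖_H ≤ R`, has a Cauchy subsequence
(`totallyBounded_of_forall_seq_exists_cauchySeq`), i.e. that its range is totally bounded
(`exists_subseq_cauchySeq_of_totallyBounded`). Given `ε`, approximate `Uₙ` by graphs of test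
functions `ψₙ` in `H` (to `δ = ε/8`) and cut off: `φₙ = θ ψₙ`, `θ = η_ϱ e^{−q_λ/2}` with a bump
`η_ϱ = 1` on `B_ϱ` supported in `B_{2ϱ}`. The `φₙ ∈ C¹_c` have supports in a fixed compact set and
are bounded in `W^{1,2}(ℝ²)`, so the tree's `C¹` Kolmogorov–Riesz lemma
`exists_finset_eLpNorm_sub_lt` (Evans, *PDE*, §5.7, proof of Thm. 1) gives a finite `ε/4`-net among
them in `L²(dx)`; the Gaussian tails are `≤ ε/4` uniformly by the moment bound
`integral_norm_sq_mul_sq_le_of_mem_gaussLamFormDomain`, and `‖uₙ − uₘ‖_{L²(μ)} < ε` follows since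
`‖u‖_{L²(μ_λ)} = ‖e^{−q_λ/2} u‖_{L²(dx)}`.

## References

* Th. Gallay, Y. Maekawa, *Existence and stability of viscous vortices*, arXiv:1610.08384, §4.1.
  [GallayMaekawa2016]
* L. C. Evans, *Partial Differential Equations*, 2nd ed., AMS (2010), §5.7, Thm. 1
  (Rellich–Kondrachov). [Evans2010]
-/

open MeasureTheory Filter Set WithLp Metric
open scoped Real RealInnerProductSpace Topology InnerProductSpace ContDiff ENNReal

noncomputable section

namespace Literature.Analysis.FluidPDE

open Literature.Analysis.UnboundedOperators

variable {lam : ℝ}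

/-! ### `L²(dx)` bookkeeping for continuous compactly supported functions -/

section L2dx

/-- `‖g‖²_{L²} = ∫ g²` for `g ∈ L²(dx)` real. [folklore] -/
theorem norm_toLp_sq_eq_integral_sq {g : EuclideanSpace ℝ (Fin 2) → ℝ} (hg : MemLp g 2 volume) :
    ‖hg.toLp g‖ ^ 2 = ∫ x, g x ^ 2 := by
  rw [norm_sq_Lp_two_eq_integral_norm_sq]
  refine integral_congr_ae ?_
  filter_upwards [MemLp.coeFn_toLp hg] with x hx
  rw [hx, Real.norm_eq_abs, sq_abs]

/-- `eLpNorm g 2 = ofReal ‖g‖_{L²}`. [folklore] -/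
theorem eLpNorm_two_eq_ofReal_norm_toLp {F : Type*} [NormedAddCommGroup F] {g : EuclideanSpace ℝ (Fin 2) → F}
    (hg : MemLp g 2 volume) : eLpNorm g 2 volume = ENNReal.ofReal ‖hg.toLp g‖ := by
  rw [ofReal_norm, Lp.enorm_toLp]

end L2dx

/-! ### The half-weight `e^{−q_λ/2}` -/

section HalfWeight

variable (lam)

/-- The quadratic form `q_λ` is smooth. [folklore] -/
theorem contDiff_quadraticLam {n : WithTop ℕ∞} :
    ContDiff ℝ n fun y : EuclideanSpace ℝ (Fin 2) => (1 + lam) / 4 * y 0 ^ 2 + (1 - lam) / 4 * y 1 ^ 2 :=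
  (contDiff_const.mul ((EuclideanSpace.proj (0 : Fin 2) : EuclideanSpace ℝ (Fin 2) →L[ℝ] ℝ).contDiff.pow 2)).add
    (contDiff_const.mul ((EuclideanSpace.proj (1 : Fin 2) : EuclideanSpace ℝ (Fin 2) →L[ℝ] ℝ).contDiff.pow 2))

/-- `e^{−q_λ/2}` is smooth. [folklore] -/
theorem contDiff_expNegHalfQuadLam {n : WithTop ℕ∞} :
    ContDiff ℝ n fun y : EuclideanSpace ℝ (Fin 2) =>
      Real.exp (-((1 + lam) / 4 * y 0 ^ 2 + (1 - lam) / 4 * y 1 ^ 2) / 2) :=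
  Real.contDiff_exp.comp ((contDiff_quadraticLam lam).neg.div_const 2)

/-- `(e^{−q/2})² = ρ_λ`. [folklore] -/
theorem expNegHalfQuadLam_sq (y : EuclideanSpace ℝ (Fin 2)) :
    Real.exp (-((1 + lam) / 4 * y 0 ^ 2 + (1 - lam) / 4 * y 1 ^ 2) / 2) ^ 2 =
      Real.exp (-((1 + lam) / 4 * y 0 ^ 2 + (1 - lam) / 4 * y 1 ^ 2)) := by
  rw [sq, ← Real.exp_add]; ring_nf

/-- The derivative of `e^{−q/2}`. [folklore] -/
theorem hasFDerivAt_expNegHalfQuadLam (x : EuclideanSpace ℝ (Fin 2)) :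
    HasFDerivAt (fun y : EuclideanSpace ℝ (Fin 2) =>
        Real.exp (-((1 + lam) / 4 * y 0 ^ 2 + (1 - lam) / 4 * y 1 ^ 2) / 2))
      (Real.exp (-((1 + lam) / 4 * x 0 ^ 2 + (1 - lam) / 4 * x 1 ^ 2) / 2) •
        ((-(1 : ℝ) / 2) • fderiv ℝ (fun y : EuclideanSpace ℝ (Fin 2) =>
          (1 + lam) / 4 * y 0 ^ 2 + (1 - lam) / 4 * y 1 ^ 2) x)) x := by
  have h1 : HasFDerivAt (fun y : EuclideanSpace ℝ (Fin 2) =>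
      -((1 + lam) / 4 * y 0 ^ 2 + (1 - lam) / 4 * y 1 ^ 2) / 2)
      ((-(1 : ℝ) / 2) • fderiv ℝ (fun y : EuclideanSpace ℝ (Fin 2) =>
          (1 + lam) / 4 * y 0 ^ 2 + (1 - lam) / 4 * y 1 ^ 2) x) x := by
    have h := ((hasFDerivAt_quadraticLam lam x).const_mul (-(1 : ℝ) / 2))
    rw [(hasFDerivAt_quadraticLam lam x).fderiv]
    refine h.congr_of_eventuallyEq (Eventually.of_forall fun y => ?_)
    simp only
    ring
  exact h1.exp

variable {lam} (hlam : lam ∈ Set.Ico (0 : ℝ) 1)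
include hlam

/-- `‖D e^{−q/2}(x)‖ ≤ e^{−q(x)/2} ‖x‖/2`. [folklore] -/
theorem norm_fderiv_expNegHalfQuadLam_le (x : EuclideanSpace ℝ (Fin 2)) :
    ‖fderiv ℝ (fun y : EuclideanSpace ℝ (Fin 2) =>
        Real.exp (-((1 + lam) / 4 * y 0 ^ 2 + (1 - lam) / 4 * y 1 ^ 2) / 2)) x‖ ≤
      Real.exp (-((1 + lam) / 4 * x 0 ^ 2 + (1 - lam) / 4 * x 1 ^ 2) / 2) * (‖x‖ / 2) := by
  rw [(hasFDerivAt_expNegHalfQuadLam lam x).fderiv, norm_smul, Real.norm_of_nonneg (Real.exp_pos _).le]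
  refine mul_le_mul_of_nonneg_left ?_ (Real.exp_pos _).le
  rw [norm_smul, Real.norm_eq_abs, show |(-(1 : ℝ) / 2)| = 1 / 2 by norm_num]
  have h := norm_fderiv_quadraticLam_le hlam x
  linarith

end HalfWeight

/-! ### The total boundedness theorem -/

section Rellich

variable (hlam : lam ∈ Set.Ico (0 : ℝ) 1)
include hlam

-- a single long proof: the default heartbeat budget for one declaration is too small
set_option maxHeartbeats 1000000 in
/-- **Compactness of `H¹(μ_λ) ↪ L²(μ_λ)`**: for `λ ∈ [0,1)` and every `R`, the first components of
the elements of the form domain `H¹(μ_λ)` of norm `≤ R` form a totally bounded subset of `L²(μ_λ)`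
(Gaussian-weighted Rellich theorem; proof in the module docstring). [cite: GallayMaekawa2016, §4.1] -/
theorem totallyBounded_fst_of_norm_le (R : ℝ) :
    TotallyBounded {u : Lp ℝ 2 (gaussLamMeasure lam) |
      ∃ U ∈ gaussLamFormDomain lam, U.fst = u ∧ ‖U‖ ≤ R} := by
  have hq : 0 < 1 - lam := by linarith [hlam.2]
  refine Literature.Analysis.OperatorTheory.totallyBounded_of_forall_seq_exists_cauchySeq fun u hu => ?_
  choose U hUH hUfst hUR using hu
  -- it suffices that the range of the sequence is totally bounded
  suffices htb : TotallyBounded (Set.range u) by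
    exact Literature.Analysis.OperatorTheory.exists_subseq_cauchySeq_of_totallyBounded htb (fun n => Set.mem_range_self n)
  refine Metric.totallyBounded_iff.2 fun ε hε => ?_
  -- notation
  set ρ : EuclideanSpace ℝ (Fin 2) → ℝ := fun y =>
    Real.exp (-((1 + lam) / 4 * y 0 ^ 2 + (1 - lam) / 4 * y 1 ^ 2)) with hρ
  set sw : EuclideanSpace ℝ (Fin 2) → ℝ := fun y =>
    Real.exp (-((1 + lam) / 4 * y 0 ^ 2 + (1 - lam) / 4 * y 1 ^ 2) / 2) with hsw
  have hsw_sq : ∀ y, sw y ^ 2 = ρ y := expNegHalfQuadLam_sq lam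
  have hsw_pos : ∀ y, 0 < sw y := fun y => Real.exp_pos _
  have hswC : ContDiff ℝ ∞ sw := contDiff_expNegHalfQuadLam lam
  have hswd : Differentiable ℝ sw := hswC.differentiable (by simp)
  set Cm : ℝ := 16 / (1 - lam) ^ 2 + 8 / (1 - lam) with hCm
  have hCm0 : 0 < Cm := by positivity
  have hR0 : 0 ≤ R := (norm_nonneg _).trans (hUR 0)
  -- Step 1: test-function approximants at distance `< δ = ε/8`
  set δ : ℝ := ε / 8 with hδ
  have hδ0 : 0 < δ := by positivity
  have hex : ∀ n, ∃ ψ : planarTestFunctions, ‖gaussLamGraph lam ψ - U n‖ < δ := by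
    intro n
    obtain ⟨φ, hlim⟩ := exists_seq_tendsto_gaussLamGraph (hUH n)
    obtain ⟨k, hk⟩ := (hlim.eventually (Metric.ball_mem_nhds _ hδ0)).exists
    exact ⟨φ k, by rw [dist_eq_norm] at hk; exact hk⟩
  choose ψ hψ using hex
  have hψR : ∀ n, ‖gaussLamGraph lam (ψ n)‖ ≤ R + δ := fun n => by
    calc ‖gaussLamGraph lam (ψ n)‖ = ‖(gaussLamGraph lam (ψ n) - U n) + U n‖ := by rw [sub_add_cancel]
      _ ≤ ‖gaussLamGraph lam (ψ n) - U n‖ + ‖U n‖ := norm_add_le _ _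
      _ ≤ δ + R := add_le_add (hψ n).le (hUR n)
      _ = R + δ := add_comm _ _
  -- Step 2: the cut-off radius `ϱ` with `√Cm · 2(R+δ)/ϱ ≤ ε/4`
  set ϱ : ℝ := 8 * Real.sqrt Cm * (R + δ) / ε + 1 with hϱ
  have hϱ0 : 0 < ϱ := by positivity
  have htail_const : Real.sqrt Cm * (2 * (R + δ)) / ϱ ≤ ε / 4 := by
    rw [div_le_iff₀ hϱ0, hϱ]
    have h1 : Real.sqrt Cm * (2 * (R + δ)) = ε / 4 * (8 * Real.sqrt Cm * (R + δ) / ε) := by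
      field_simp; ring
    rw [h1]
    have : 0 ≤ ε / 4 := by positivity
    nlinarith [Real.sqrt_nonneg Cm]
  -- the bump `η = 1` on `B_ϱ`, supported in `B_{2ϱ}`, and the multiplier `θ = η e^{−q/2}`
  let η : ContDiffBump (0 : EuclideanSpace ℝ (Fin 2)) := ⟨ϱ, 2 * ϱ, hϱ0, by linarith⟩
  have hηc : ContDiff ℝ ∞ (η : EuclideanSpace ℝ (Fin 2) → ℝ) := η.contDiff
  have hηs : HasCompactSupport (η : EuclideanSpace ℝ (Fin 2) → ℝ) := η.hasCompactSupport
  have hηd : Differentiable ℝ (η : EuclideanSpace ℝ (Fin 2) → ℝ) := hηc.differentiable (by simp)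
  obtain ⟨Lη, hLη⟩ := (hηc.continuous_fderiv (by simp)).bounded_above_of_compact_support (hηs.fderiv (𝕜 := ℝ))
  have hLη0 : 0 ≤ Lη := (norm_nonneg _).trans (hLη 0)
  set θ : EuclideanSpace ℝ (Fin 2) → ℝ := fun x => η x * sw x with hθ
  have hθC : ContDiff ℝ ∞ θ := hηc.mul hswC
  have hθd : Differentiable ℝ θ := hθC.differentiable (by simp)
  have hθs : HasCompactSupport θ := hηs.mul_right
  have hθ_le : ∀ x, |θ x| ≤ sw x := fun x => by
    rw [hθ]; dsimp only
    rw [abs_mul, abs_of_nonneg η.nonneg, abs_of_pos (hsw_pos x)]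
    exact mul_le_of_le_one_left (hsw_pos x).le η.le_one
  -- `‖Dθ x‖ ≤ (Lη + ϱ) e^{−q(x)/2}`
  have hDθ : ∀ x, ‖fderiv ℝ θ x‖ ≤ (Lη + ϱ) * sw x := by
    intro x
    have hd : HasFDerivAt θ (η x • fderiv ℝ sw x + sw x • fderiv ℝ (η : EuclideanSpace ℝ (Fin 2) → ℝ) x) x := by
      have := (hηd x).hasFDerivAt.mul (hswd x).hasFDerivAt
      exact this
    rw [hd.fderiv]
    have h1 : ‖η x • fderiv ℝ sw x‖ ≤ ϱ * sw x := by
      rw [norm_smul, Real.norm_of_nonneg η.nonneg]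
      by_cases hx : ‖x‖ ≤ 2 * ϱ
      · calc η x * ‖fderiv ℝ sw x‖ ≤ 1 * (sw x * (‖x‖ / 2)) :=
              mul_le_mul η.le_one (norm_fderiv_expNegHalfQuadLam_le hlam x) (norm_nonneg _) zero_le_one
          _ ≤ ϱ * sw x := by rw [one_mul, mul_comm]; nlinarith [hsw_pos x]
      · have h0 : η x = 0 := η.zero_of_le_dist (by rw [dist_zero_right]; linarith)
        rw [h0, zero_mul]; positivity
    have h2 : ‖sw x • fderiv ℝ (η : EuclideanSpace ℝ (Fin 2) → ℝ) x‖ ≤ Lη * sw x := by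
      rw [norm_smul, Real.norm_of_nonneg (hsw_pos x).le, mul_comm]
      exact mul_le_mul_of_nonneg_right (hLη x) (hsw_pos x).le
    calc _ ≤ ‖η x • fderiv ℝ sw x‖ + ‖sw x • fderiv ℝ (η : EuclideanSpace ℝ (Fin 2) → ℝ) x‖ := norm_add_le _ _
      _ ≤ ϱ * sw x + Lη * sw x := add_le_add h1 h2
      _ = (Lη + ϱ) * sw x := by ring
  -- Step 3: the cut-off family `φ n = θ ψₙ`
  set φ : ℕ → EuclideanSpace ℝ (Fin 2) → ℝ := fun n x => θ x * (ψ n : EuclideanSpace ℝ (Fin 2) → ℝ) x with hφ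
  have hφC : ∀ n, ContDiff ℝ 1 (φ n) := fun n =>
    (hθC.mul (planarTestFunctions.contDiff (ψ n))).of_le (by simp)
  have hφcont : ∀ n, Continuous (φ n) := fun n => (hφC n).continuous
  have hφs : ∀ n, HasCompactSupport (φ n) := fun n => hθs.mul_right
  set K : Set (EuclideanSpace ℝ (Fin 2)) := closedBall 0 (2 * ϱ) with hK
  have hKc : IsCompact K := isCompact_closedBall _ _
  have hφK : ∀ n, tsupport (φ n) ⊆ K := by
    intro n
    refine (tsupport_mul_subset_left).trans ((tsupport_mul_subset_left).trans ?_)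
    rw [η.tsupport_eq]
  -- `L²` norms of the `φ n` and of their gradients in terms of the graph norms
  have hmemφ : ∀ n, MemLp (φ n) 2 volume := fun n => (hφcont n).memLp_of_hasCompactSupport (hφs n)
  have hψcont : ∀ n, Continuous (ψ n : EuclideanSpace ℝ (Fin 2) → ℝ) := fun n => planarTestFunctions.continuous (ψ n)
  have hψsupp : ∀ n, HasCompactSupport (ψ n : EuclideanSpace ℝ (Fin 2) → ℝ) := fun n => planarTestFunctions.hasCompactSupport (ψ n)
  have hfst_sq := fun g : planarTestFunctions => norm_sq_gaussLamGraph_fst (lam := lam) g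
  have hsnd_sq := fun g : planarTestFunctions => norm_sq_gaussLamGraph_snd (lam := lam) g
  have hfst_le : ∀ g : planarTestFunctions, ‖(gaussLamGraph lam g).fst‖ ≤ ‖gaussLamGraph lam g‖ := fun g => by
    have h := WithLp.prod_norm_sq_eq_of_L2 (gaussLamGraph lam g)
    nlinarith [norm_nonneg (gaussLamGraph lam g), norm_nonneg (gaussLamGraph lam g).fst,
      sq_nonneg ‖(gaussLamGraph lam g).snd‖]
  have hsnd_le : ∀ g : planarTestFunctions, ‖(gaussLamGraph lam g).snd‖ ≤ ‖gaussLamGraph lam g‖ := fun g => by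
    have h := WithLp.prod_norm_sq_eq_of_L2 (gaussLamGraph lam g)
    nlinarith [norm_nonneg (gaussLamGraph lam g), norm_nonneg (gaussLamGraph lam g).snd,
      sq_nonneg ‖(gaussLamGraph lam g).fst‖]
  -- compact support of products with a test function
  have hsupp_of : ∀ (g : planarTestFunctions) {f : EuclideanSpace ℝ (Fin 2) → ℝ},
      (∀ x, (g : EuclideanSpace ℝ (Fin 2) → ℝ) x = 0 → f x = 0) → HasCompactSupport f :=
    fun g {f} hf => (planarTestFunctions.hasCompactSupport g).mono
      (Function.support_subset_iff'.2 fun x hx => hf x (Function.notMem_support.1 hx))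
  have hψDc : ∀ g : planarTestFunctions, Continuous fun x => fderiv ℝ (g : EuclideanSpace ℝ (Fin 2) → ℝ) x := fun g =>
    (planarTestFunctions.contDiff g).continuous_fderiv (by simp)
  have hψDs : ∀ g : planarTestFunctions, HasCompactSupport fun x => fderiv ℝ (g : EuclideanSpace ℝ (Fin 2) → ℝ) x :=
    fun g => (planarTestFunctions.hasCompactSupport g).fderiv (𝕜 := ℝ)
  -- (a) `‖φ n‖_{L²(dx)} ≤ ‖(graph ψₙ).fst‖ ≤ R + δ`
  have hθsq_le : ∀ x (t : ℝ), (θ x * t) ^ 2 ≤ t ^ 2 * ρ x := by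
    intro x t
    rw [mul_pow, ← hsw_sq, mul_comm]
    refine mul_le_mul_of_nonneg_left ?_ (sq_nonneg _)
    have h := hθ_le x
    rw [← sq_abs (θ x)]
    exact pow_le_pow_left₀ (abs_nonneg _) h 2
  have hφA_real : ∀ n, ‖(hmemφ n).toLp (φ n)‖ ≤ R + δ := by
    intro n
    have hint : Integrable (fun x => (ψ n : EuclideanSpace ℝ (Fin 2) → ℝ) x ^ 2 * ρ x) :=
      (((hψcont n).pow 2).mul (continuous_expNegQuadLam lam)).integrable_of_hasCompactSupport
        (hsupp_of (ψ n) fun x hx => by simp [hx])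
    have h1 : ‖(hmemφ n).toLp (φ n)‖ ^ 2 ≤ ‖(gaussLamGraph lam (ψ n)).fst‖ ^ 2 := by
      rw [norm_toLp_sq_eq_integral_sq, hfst_sq]
      exact integral_mono_of_nonneg (Eventually.of_forall fun x => sq_nonneg _) hint
        (Eventually.of_forall fun x => hθsq_le x _)
    have h2 : ‖(gaussLamGraph lam (ψ n)).fst‖ ≤ R + δ := (hfst_le _).trans (hψR n)
    have h3 : ‖(hmemφ n).toLp (φ n)‖ ≤ ‖(gaussLamGraph lam (ψ n)).fst‖ :=
      (pow_le_pow_iff_left₀ (norm_nonneg _) (norm_nonneg _) two_ne_zero).1 h1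
    exact h3.trans h2
  have hφA : ∀ n, eLpNorm (φ n) 2 volume ≤ ENNReal.ofReal (R + δ) := fun n => by
    rw [eLpNorm_two_eq_ofReal_norm_toLp (hmemφ n)]
    exact ENNReal.ofReal_le_ofReal (hφA_real n)
  -- (b) `‖Dφ n‖_{L²(dx)} ≤ B`
  set cθ : ℝ := Lη + ϱ with hcθ
  have hcθ0 : 0 ≤ cθ := by positivity
  set B : ℝ := Real.sqrt (2 * (1 + cθ ^ 2)) * (R + δ) with hB
  -- the real majorant `g n = e^{−q/2} (‖Dψₙ‖ + cθ |ψₙ|)`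
  set g : ℕ → EuclideanSpace ℝ (Fin 2) → ℝ := fun n x =>
    sw x * (‖fderiv ℝ (ψ n : EuclideanSpace ℝ (Fin 2) → ℝ) x‖ + cθ * |(ψ n : EuclideanSpace ℝ (Fin 2) → ℝ) x|) with hg
  have hgc : ∀ n, Continuous (g n) := fun n =>
    hswC.continuous.mul ((hψDc (ψ n)).norm.add (continuous_const.mul (hψcont n).abs))
  have hgs : ∀ n, HasCompactSupport (g n) := fun n =>
    (((hψDs (ψ n)).norm.add ((hψsupp n).abs.mul_left)).mul_left)
  have hmemg : ∀ n, MemLp (g n) 2 volume := fun n => (hgc n).memLp_of_hasCompactSupport (hgs n)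
  have hDφ_le : ∀ n x, ‖fderiv ℝ (φ n) x‖ ≤ g n x := by
    intro n x
    have hψd := ((planarTestFunctions.contDiff (ψ n)).differentiable (by simp)) x
    have hd : HasFDerivAt (φ n) (θ x • fderiv ℝ (ψ n : EuclideanSpace ℝ (Fin 2) → ℝ) x +
        (ψ n : EuclideanSpace ℝ (Fin 2) → ℝ) x • fderiv ℝ θ x) x := (hθd x).hasFDerivAt.mul hψd.hasFDerivAt
    rw [hd.fderiv, hg]
    dsimp only
    calc _ ≤ ‖θ x • fderiv ℝ (ψ n : EuclideanSpace ℝ (Fin 2) → ℝ) x‖ +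
          ‖(ψ n : EuclideanSpace ℝ (Fin 2) → ℝ) x • fderiv ℝ θ x‖ := norm_add_le _ _
      _ ≤ sw x * ‖fderiv ℝ (ψ n : EuclideanSpace ℝ (Fin 2) → ℝ) x‖ +
          |(ψ n : EuclideanSpace ℝ (Fin 2) → ℝ) x| * ((Lη + ϱ) * sw x) := by
          rw [norm_smul, norm_smul, Real.norm_eq_abs, Real.norm_eq_abs]
          exact add_le_add (mul_le_mul_of_nonneg_right (hθ_le x) (norm_nonneg _))
            (mul_le_mul_of_nonneg_left (hDθ x) (abs_nonneg _))
      _ = sw x * (‖fderiv ℝ (ψ n : EuclideanSpace ℝ (Fin 2) → ℝ) x‖ + cθ * |(ψ n : EuclideanSpace ℝ (Fin 2) → ℝ) x|) := by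
          rw [hcθ]; ring
  have hg_sq_le : ∀ n x, g n x ^ 2 ≤ 2 * (‖fderiv ℝ (ψ n : EuclideanSpace ℝ (Fin 2) → ℝ) x‖ ^ 2 * ρ x) +
      2 * cθ ^ 2 * ((ψ n : EuclideanSpace ℝ (Fin 2) → ℝ) x ^ 2 * ρ x) := by
    intro n x
    have key : ∀ a b : ℝ, (a + cθ * b) ^ 2 ≤ 2 * a ^ 2 + 2 * cθ ^ 2 * b ^ 2 := fun a b => by
      nlinarith [sq_nonneg (a - cθ * b)]
    have hρx : 0 ≤ ρ x := (Real.exp_pos _).le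
    calc g n x ^ 2 = (‖fderiv ℝ (ψ n : EuclideanSpace ℝ (Fin 2) → ℝ) x‖ + cθ * |(ψ n : EuclideanSpace ℝ (Fin 2) → ℝ) x|) ^ 2 * ρ x := by
          rw [hg]; dsimp only; rw [mul_pow, hsw_sq, mul_comm]
      _ ≤ (2 * ‖fderiv ℝ (ψ n : EuclideanSpace ℝ (Fin 2) → ℝ) x‖ ^ 2 + 2 * cθ ^ 2 * |(ψ n : EuclideanSpace ℝ (Fin 2) → ℝ) x| ^ 2) * ρ x :=
          mul_le_mul_of_nonneg_right (key _ _) hρx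
      _ = _ := by rw [sq_abs]; ring
  have hsuppD_of : ∀ (g' : planarTestFunctions) {f : EuclideanSpace ℝ (Fin 2) → ℝ},
      (∀ x, fderiv ℝ (g' : EuclideanSpace ℝ (Fin 2) → ℝ) x = 0 → f x = 0) → HasCompactSupport f :=
    fun g' {f} hf => (hψDs g').mono
      (Function.support_subset_iff'.2 fun x hx => hf x (Function.notMem_support.1 hx))
  have hgB : ∀ n, ‖(hmemg n).toLp (g n)‖ ≤ B := by
    intro n
    have hintD : Integrable (fun x => ‖fderiv ℝ (ψ n : EuclideanSpace ℝ (Fin 2) → ℝ) x‖ ^ 2 * ρ x) :=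
      (((hψDc (ψ n)).norm.pow 2).mul (continuous_expNegQuadLam lam)).integrable_of_hasCompactSupport
        (hsuppD_of (ψ n) fun x hx => by simp [hx])
    have hint0 : Integrable (fun x => (ψ n : EuclideanSpace ℝ (Fin 2) → ℝ) x ^ 2 * ρ x) :=
      (((hψcont n).pow 2).mul (continuous_expNegQuadLam lam)).integrable_of_hasCompactSupport
        (hsupp_of (ψ n) fun x hx => by simp [hx])
    have hgi2 : Integrable (fun x => 2 * (‖fderiv ℝ (ψ n : EuclideanSpace ℝ (Fin 2) → ℝ) x‖ ^ 2 * ρ x) +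
        2 * cθ ^ 2 * ((ψ n : EuclideanSpace ℝ (Fin 2) → ℝ) x ^ 2 * ρ x)) :=
      (hintD.const_mul 2).add (hint0.const_mul (2 * cθ ^ 2))
    have hle := integral_mono_of_nonneg (μ := (volume : Measure (EuclideanSpace ℝ (Fin 2))))
      (Eventually.of_forall fun x => sq_nonneg (g n x)) hgi2 (Eventually.of_forall fun x => hg_sq_le n x)
    have hsplit : ∫ x, (2 * (‖fderiv ℝ (ψ n : EuclideanSpace ℝ (Fin 2) → ℝ) x‖ ^ 2 * ρ x) +
        2 * cθ ^ 2 * ((ψ n : EuclideanSpace ℝ (Fin 2) → ℝ) x ^ 2 * ρ x)) =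
        2 * ‖(gaussLamGraph lam (ψ n)).snd‖ ^ 2 + 2 * cθ ^ 2 * ‖(gaussLamGraph lam (ψ n)).fst‖ ^ 2 := by
      rw [integral_add (hintD.const_mul 2) (hint0.const_mul (2 * cθ ^ 2)), integral_const_mul, integral_const_mul,
        hfst_sq, hsnd_sq]
    have h1 : ‖(hmemg n).toLp (g n)‖ ^ 2 ≤ 2 * ‖(gaussLamGraph lam (ψ n)).snd‖ ^ 2 +
        2 * cθ ^ 2 * ‖(gaussLamGraph lam (ψ n)).fst‖ ^ 2 := by
      rw [norm_toLp_sq_eq_integral_sq, ← hsplit]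
      exact hle
    have h2 : 2 * ‖(gaussLamGraph lam (ψ n)).snd‖ ^ 2 + 2 * cθ ^ 2 * ‖(gaussLamGraph lam (ψ n)).fst‖ ^ 2 ≤ B ^ 2 := by
      have hpos : (0 : ℝ) ≤ 2 * (1 + cθ ^ 2) := by positivity
      rw [hB, mul_pow, Real.sq_sqrt hpos]
      have hs := hsnd_le (ψ n)
      have hf := hfst_le (ψ n)
      have hRn := hψR n
      have e1 : ‖(gaussLamGraph lam (ψ n)).snd‖ ^ 2 ≤ (R + δ) ^ 2 :=
        pow_le_pow_left₀ (norm_nonneg _) (hs.trans hRn) 2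
      have e2 : ‖(gaussLamGraph lam (ψ n)).fst‖ ^ 2 ≤ (R + δ) ^ 2 :=
        pow_le_pow_left₀ (norm_nonneg _) (hf.trans hRn) 2
      have h3 := mul_le_mul_of_nonneg_left e2 (by positivity : (0 : ℝ) ≤ 2 * cθ ^ 2)
      linarith
    have hB0 : 0 ≤ B := by positivity
    exact (pow_le_pow_iff_left₀ (norm_nonneg _) hB0 two_ne_zero).1 (h1.trans h2)
  have hφB : ∀ n, eLpNorm (fderiv ℝ (φ n)) 2 volume ≤ ENNReal.ofReal B := by
    intro n
    calc eLpNorm (fderiv ℝ (φ n)) 2 volume ≤ eLpNorm (g n) 2 volume := eLpNorm_mono_real (hDφ_le n)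
      _ = ENNReal.ofReal ‖(hmemg n).toLp (g n)‖ := eLpNorm_two_eq_ofReal_norm_toLp (hmemg n)
      _ ≤ ENNReal.ofReal B := ENNReal.ofReal_le_ofReal (hgB n)
  -- Step 4: a finite `ε/4`-net among the `φ n` in `L²(dx)` (Kolmogorov–Riesz, `C¹` form)
  have hε4 : (0 : ℝ≥0∞) < ENNReal.ofReal (ε / 4) := ENNReal.ofReal_pos.2 (by positivity)
  obtain ⟨sF, hsF⟩ := Literature.Analysis.FunctionSpaces.exists_finset_eLpNorm_sub_lt
    (volume : Measure (EuclideanSpace ℝ (Fin 2))) (p := 2) (F := ℝ) one_le_two hKc φ hφC hφK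
    (A := ENNReal.ofReal (R + δ)) (B := ENNReal.ofReal B) ENNReal.ofReal_ne_top ENNReal.ofReal_ne_top hφA hφB hε4
  -- Step 5: the Gaussian tail bound `‖(1 − η) e^{−q/2} g‖₂ ≤ √Cm ‖graph g‖ / ϱ` for test functions `g`
  have htail : ∀ g' : planarTestFunctions,
      ∃ hmem : MemLp (fun x => (1 - η x) * sw x * (g' : EuclideanSpace ℝ (Fin 2) → ℝ) x) 2 volume,
        ‖hmem.toLp _‖ ≤ Real.sqrt Cm * ‖gaussLamGraph lam g'‖ / ϱ := by
    intro g'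
    have hcont1 : Continuous fun x => (1 - η x) * sw x * (g' : EuclideanSpace ℝ (Fin 2) → ℝ) x :=
      ((continuous_const.sub η.continuous).mul hswC.continuous).mul (planarTestFunctions.continuous g')
    have hmem : MemLp (fun x => (1 - η x) * sw x * (g' : EuclideanSpace ℝ (Fin 2) → ℝ) x) 2 volume :=
      hcont1.memLp_of_hasCompactSupport ((planarTestFunctions.hasCompactSupport g').mul_left)
    refine ⟨hmem, ?_⟩
    -- the moment bound for the graph of `g'`
    obtain ⟨hmi, hmle⟩ := integral_norm_sq_mul_sq_le_of_mem_gaussLamFormDomain hlam (gaussLamGraph_mem lam g')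
    have hae := (ae_gaussLamMeasure_iff lam).1 (MemLp.coeFn_toLp (memLp_planarTestFunction lam g'))
    have heq : ∫ x, ‖x‖ ^ 2 * (g' : EuclideanSpace ℝ (Fin 2) → ℝ) x ^ 2 * ρ x =
        ∫ x, ‖x‖ ^ 2 * ((gaussLamGraph lam g').fst : EuclideanSpace ℝ (Fin 2) → ℝ) x ^ 2 * ρ x := by
      refine integral_congr_ae ?_
      filter_upwards [hae] with x hx
      rw [gaussLamGraph_fst, hx]
    have hbd : 16 / (1 - lam) ^ 2 * ‖(gaussLamGraph lam g').snd‖ ^ 2 + 8 / (1 - lam) * ‖(gaussLamGraph lam g').fst‖ ^ 2 ≤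
        Cm * ‖gaussLamGraph lam g'‖ ^ 2 := by
      rw [hCm, add_mul]
      have hs := hsnd_le g'
      have hf := hfst_le g'
      have e1 : ‖(gaussLamGraph lam g').snd‖ ^ 2 ≤ ‖gaussLamGraph lam g'‖ ^ 2 := pow_le_pow_left₀ (norm_nonneg _) hs 2
      have e2 : ‖(gaussLamGraph lam g').fst‖ ^ 2 ≤ ‖gaussLamGraph lam g'‖ ^ 2 := pow_le_pow_left₀ (norm_nonneg _) hf 2
      have h16 : (0:ℝ) ≤ 16 / (1 - lam) ^ 2 := by positivity
      have h8 : (0:ℝ) ≤ 8 / (1 - lam) := by positivity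
      exact add_le_add (mul_le_mul_of_nonneg_left e1 h16) (mul_le_mul_of_nonneg_left e2 h8)
    have hmle' : ∫ x, ‖x‖ ^ 2 * (g' : EuclideanSpace ℝ (Fin 2) → ℝ) x ^ 2 * ρ x ≤ Cm * ‖gaussLamGraph lam g'‖ ^ 2 :=
      (heq.le.trans hmle).trans hbd
    have hint_m : Integrable (fun x => ‖x‖ ^ 2 * (g' : EuclideanSpace ℝ (Fin 2) → ℝ) x ^ 2 * ρ x) := by
      refine hmi.congr ?_
      filter_upwards [hae] with x hx
      rw [gaussLamGraph_fst, hx]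
    -- pointwise tail inequality
    have hpt : ∀ x, ((1 - η x) * sw x * (g' : EuclideanSpace ℝ (Fin 2) → ℝ) x) ^ 2 ≤
        ϱ⁻¹ ^ 2 * (‖x‖ ^ 2 * (g' : EuclideanSpace ℝ (Fin 2) → ℝ) x ^ 2 * ρ x) := by
      intro x
      by_cases hx : ‖x‖ ≤ ϱ
      · have h1 : η x = 1 := η.one_of_mem_closedBall (by rw [mem_closedBall, dist_zero_right]; exact hx)
        rw [h1, sub_self, zero_mul, zero_mul, zero_pow two_ne_zero]
        positivity
      · push Not at hx
        have h01 : 0 ≤ 1 - η x := sub_nonneg.2 η.le_one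
        have h11 : 1 - η x ≤ 1 := by linarith [η.nonneg (x := x)]
        have hsq1 : (1 - η x) ^ 2 ≤ 1 := by nlinarith
        have hrat : 1 ≤ ϱ⁻¹ ^ 2 * ‖x‖ ^ 2 := by
          rw [← mul_pow, inv_mul_eq_div, one_le_sq_iff_one_le_abs, abs_of_nonneg (by positivity),
            le_div_iff₀ hϱ0]
          linarith
        calc ((1 - η x) * sw x * (g' : EuclideanSpace ℝ (Fin 2) → ℝ) x) ^ 2
            = (1 - η x) ^ 2 * ((g' : EuclideanSpace ℝ (Fin 2) → ℝ) x ^ 2 * ρ x) := by rw [mul_pow, mul_pow, hsw_sq]; ring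
          _ ≤ 1 * ((g' : EuclideanSpace ℝ (Fin 2) → ℝ) x ^ 2 * ρ x) :=
              mul_le_mul_of_nonneg_right hsq1 (by positivity)
          _ ≤ (ϱ⁻¹ ^ 2 * ‖x‖ ^ 2) * ((g' : EuclideanSpace ℝ (Fin 2) → ℝ) x ^ 2 * ρ x) :=
              mul_le_mul_of_nonneg_right hrat (by positivity)
          _ = _ := by ring
    have hsq : ‖hmem.toLp _‖ ^ 2 ≤ (Real.sqrt Cm * ‖gaussLamGraph lam g'‖ / ϱ) ^ 2 := by
      rw [norm_toLp_sq_eq_integral_sq]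
      calc ∫ x, ((1 - η x) * sw x * (g' : EuclideanSpace ℝ (Fin 2) → ℝ) x) ^ 2
          ≤ ∫ x, ϱ⁻¹ ^ 2 * (‖x‖ ^ 2 * (g' : EuclideanSpace ℝ (Fin 2) → ℝ) x ^ 2 * ρ x) :=
            integral_mono_of_nonneg (Eventually.of_forall fun x => sq_nonneg _) (hint_m.const_mul _)
              (Eventually.of_forall hpt)
        _ = ϱ⁻¹ ^ 2 * ∫ x, ‖x‖ ^ 2 * (g' : EuclideanSpace ℝ (Fin 2) → ℝ) x ^ 2 * ρ x := integral_const_mul _ _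
        _ ≤ ϱ⁻¹ ^ 2 * (Cm * ‖gaussLamGraph lam g'‖ ^ 2) := mul_le_mul_of_nonneg_left hmle' (by positivity)
        _ = (Real.sqrt Cm * ‖gaussLamGraph lam g'‖ / ϱ) ^ 2 := by
            rw [div_eq_mul_inv, mul_pow, mul_pow, Real.sq_sqrt hCm0.le]; ring
    exact (pow_le_pow_iff_left₀ (norm_nonneg _) (by positivity) two_ne_zero).1 hsq
  -- Step 6: the net
  refine ⟨(fun m => u m) '' (sF : Set ℕ), sF.finite_toSet.image _, ?_⟩
  rintro _ ⟨n, rfl⟩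
  obtain ⟨m, hm, hnm⟩ := hsF n
  refine mem_iUnion₂.2 ⟨u m, mem_image_of_mem _ (Finset.mem_coe.2 hm), ?_⟩
  rw [mem_ball, dist_eq_norm]
  -- `g' = ψₙ − ψₘ`
  set g' : planarTestFunctions := ψ n - ψ m with hg'
  have hg'_coe : ∀ x, (g' : EuclideanSpace ℝ (Fin 2) → ℝ) x =
      (ψ n : EuclideanSpace ℝ (Fin 2) → ℝ) x - (ψ m : EuclideanSpace ℝ (Fin 2) → ℝ) x := fun x => rfl
  have hgraph_sub : gaussLamGraph lam g' = gaussLamGraph lam (ψ n) - gaussLamGraph lam (ψ m) := map_sub _ _ _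
  have hgraph_norm : ‖gaussLamGraph lam g'‖ ≤ 2 * (R + δ) := by
    rw [hgraph_sub]
    calc _ ≤ ‖gaussLamGraph lam (ψ n)‖ + ‖gaussLamGraph lam (ψ m)‖ := norm_sub_le _ _
      _ ≤ (R + δ) + (R + δ) := add_le_add (hψR n) (hψR m)
      _ = 2 * (R + δ) := by ring
  -- the two pieces of `e^{−q/2} g'`
  obtain ⟨hmem1, htail1⟩ := htail g'
  have hcontθ : Continuous fun x => θ x * (g' : EuclideanSpace ℝ (Fin 2) → ℝ) x :=
    hθC.continuous.mul (planarTestFunctions.continuous g')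
  have hmem2 : MemLp (fun x => θ x * (g' : EuclideanSpace ℝ (Fin 2) → ℝ) x) 2 volume :=
    hcontθ.memLp_of_hasCompactSupport ((planarTestFunctions.hasCompactSupport g').mul_left)
  have hmem12 : MemLp (fun x => sw x * (g' : EuclideanSpace ℝ (Fin 2) → ℝ) x) 2 volume :=
    (hswC.continuous.mul (planarTestFunctions.continuous g')).memLp_of_hasCompactSupport
      ((planarTestFunctions.hasCompactSupport g').mul_left)
  -- `e^{−q/2} g' = (1 − η) e^{−q/2} g' + θ g'`
  have hsum : hmem12.toLp _ = hmem1.toLp _ + hmem2.toLp _ := by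
    rw [← MemLp.toLp_add]
    congr 1
    funext x
    simp only [Pi.add_apply, hθ]
    ring
  -- `‖(graph g').fst‖_{L²(μ)} = ‖e^{−q/2} g'‖_{L²(dx)}`
  have hnorm_eq : ‖(gaussLamGraph lam g').fst‖ = ‖hmem12.toLp _‖ := by
    have h1 : ‖(gaussLamGraph lam g').fst‖ ^ 2 = ‖hmem12.toLp _‖ ^ 2 := by
      rw [hfst_sq, norm_toLp_sq_eq_integral_sq]
      exact integral_congr_ae (Eventually.of_forall fun x => by dsimp only; rw [mul_pow, hsw_sq, mul_comm])
    exact (pow_left_inj₀ (norm_nonneg _) (norm_nonneg _) two_ne_zero).1 h1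
  -- `‖θ g'‖_{L²(dx)} < ε/4` from the net
  have hθg : ‖hmem2.toLp _‖ < ε / 4 := by
    rw [Lp.norm_toLp]
    refine ENNReal.toReal_lt_of_lt_ofReal ?_
    have heq : (fun x => θ x * (g' : EuclideanSpace ℝ (Fin 2) → ℝ) x) = φ n - φ m := by
      funext x
      simp only [Pi.sub_apply, hφ, hg'_coe]
      ring
    rw [heq]
    exact hnm
  -- the first components
  have hu_n : ‖u n - (gaussLamGraph lam (ψ n)).fst‖ < δ := by
    have h1 : u n - (gaussLamGraph lam (ψ n)).fst = (U n - gaussLamGraph lam (ψ n)).fst := by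
      rw [WithLp.sub_fst, hUfst]
    rw [h1]
    have h2 := WithLp.prod_norm_sq_eq_of_L2 (U n - gaussLamGraph lam (ψ n))
    have h3 : ‖(U n - gaussLamGraph lam (ψ n)).fst‖ ≤ ‖U n - gaussLamGraph lam (ψ n)‖ := by
      nlinarith [norm_nonneg (U n - gaussLamGraph lam (ψ n)), norm_nonneg (U n - gaussLamGraph lam (ψ n)).fst,
        sq_nonneg ‖(U n - gaussLamGraph lam (ψ n)).snd‖]
    have h4 : ‖U n - gaussLamGraph lam (ψ n)‖ < δ := by rw [norm_sub_rev]; exact hψ n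
    exact h3.trans_lt h4
  have hu_m : ‖(gaussLamGraph lam (ψ m)).fst - u m‖ < δ := by
    have h1 : (gaussLamGraph lam (ψ m)).fst - u m = (gaussLamGraph lam (ψ m) - U m).fst := by
      rw [WithLp.sub_fst, hUfst]
    rw [h1]
    have h3 : ‖(gaussLamGraph lam (ψ m) - U m).fst‖ ≤ ‖gaussLamGraph lam (ψ m) - U m‖ := by
      have h2 := WithLp.prod_norm_sq_eq_of_L2 (gaussLamGraph lam (ψ m) - U m)
      nlinarith [norm_nonneg (gaussLamGraph lam (ψ m) - U m), norm_nonneg (gaussLamGraph lam (ψ m) - U m).fst,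
        sq_nonneg ‖(gaussLamGraph lam (ψ m) - U m).snd‖]
    exact h3.trans_lt (hψ m)
  have hmid : ‖(gaussLamGraph lam (ψ n)).fst - (gaussLamGraph lam (ψ m)).fst‖ ≤ ε / 4 + ε / 4 := by
    have h1 : (gaussLamGraph lam (ψ n)).fst - (gaussLamGraph lam (ψ m)).fst = (gaussLamGraph lam g').fst := by
      rw [hgraph_sub, WithLp.sub_fst]
    rw [h1, hnorm_eq, hsum]
    refine (norm_add_le _ _).trans (add_le_add ?_ hθg.le)
    calc ‖hmem1.toLp _‖ ≤ Real.sqrt Cm * ‖gaussLamGraph lam g'‖ / ϱ := htail1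
      _ ≤ Real.sqrt Cm * (2 * (R + δ)) / ϱ := by gcongr
      _ ≤ ε / 4 := htail_const
  have heqsum : u n - u m = (u n - (gaussLamGraph lam (ψ n)).fst) +
      ((gaussLamGraph lam (ψ n)).fst - (gaussLamGraph lam (ψ m)).fst) +
      ((gaussLamGraph lam (ψ m)).fst - u m) := by abel
  have h3 := norm_add₃_le (a := u n - (gaussLamGraph lam (ψ n)).fst)
    (b := (gaussLamGraph lam (ψ n)).fst - (gaussLamGraph lam (ψ m)).fst)
    (c := (gaussLamGraph lam (ψ m)).fst - u m)
  rw [heqsum]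
  linarith

/-- **Relative compactness**: the closure in `L²(μ_λ)` of the first components of a bounded subset
of `H¹(μ_λ)` is compact. [folklore] -/
theorem isCompact_closure_fst_of_norm_le (R : ℝ) :
    IsCompact (closure {u : Lp ℝ 2 (gaussLamMeasure lam) |
      ∃ U ∈ gaussLamFormDomain lam, U.fst = u ∧ ‖U‖ ≤ R}) :=
  isCompact_iff_totallyBounded_isComplete.2
    ⟨(totallyBounded_fst_of_norm_le hlam R).closure, isClosed_closure.isComplete⟩

end Rellich

end Literature.Analysis.FluidPDE
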